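import Literature.MathematicalPhysics.QuantumLattice.WeightedOpenClusterBounds
import HarnessLib

/-!
# The UNIFORM admissible weight of a window: `w_B(Y) = M / #{translates of Y inside B}` —
# turnkey weighted-cluster bounds (T = 0 floor, T > 0 cap) for every finite-range lattice-fermion model

Topic `Literature/MathematicalPhysics/QuantumLattice` (family `hubbard`; crew hubbard-fast S2 «families of models, T ≥ 0»).
`WeightedOpenClusterBounds` proves, for every ADMISSIBLE weight `w` on a window `B` (for every interacting shape `X ∋ 0`:
`Σ_{y ∈ B : X + y ⊆ B} w(X + y) = M`), the translation-class identity `Σ_{X ⊆ B} w(X) ω(Ψ X) = M ω(E_Ψ) + w(∅)ω(Ψ∅)`, the weighted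
Anderson bound (T = 0) and the entropy-subadditivity pressure cap (T > 0). This file supplies the CANONICAL admissible weight, so that the
law is turnkey for any model:

* `placementCount B Y = #{v ∈ ℤ^d : Y + v ⊆ B}` (for nonempty `Y`; `0` for `Y = ∅`), computed choice-free as the number of `v = b − y`
  (`b ∈ B`, `y ∈ Y`) with `Y + v ⊆ B`; it is translation invariant in `Y` (`placementCount_shiftSet`) and for a rooted shape `X ∋ 0` it is
  `#{y ∈ B : X + y ⊆ B}` (`placementCount_eq_card_filter`);
* `uniformClusterWeight B M Y = M / placementCount B Y` — **admissible of mass `M` for EVERY interaction all of whose interacting rooted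
  shapes have a translate inside `B`** (`uniformClusterWeight_admissible`); `uniformClusterWeight B M ∅ = 0` (no constant term);
  a range-`R` interaction fits in the box `[0,n)^d` as soon as `2⌊R⌋ + 1 ≤ n` (`exists_shiftSet_subset_halfOpenBox_of_apply_ne_zero`);
* the turnkey bounds: **`le_mul_meanEnergy_of_posSemidef_uniformWeight`** (T = 0: `H^{w_B}_B + G − q ⪰ 0 ⇒ q ≤ |B|… M·e_Ψ(ω)` for every
  translation-invariant `ω`) and **`varPressure_le_log_partitionFn_uniformWeight`** (T > 0: `n^d·P(β,Ψ) ≤ log Re Tr e^{−(βH^{w}_{[0,n)^d} − G)}`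
  with `w = uniformClusterWeight [0,n)^d n^d`, every real `β`, every Hermitian multiplier `G` killed by translation-invariant states).

For the square-lattice `t–t'` Hubbard model in `[0,ℓ)²` the uniform weight is `1` on sites, `ℓ/(ℓ−1)` on nearest-neighbour bonds and
`(ℓ/(ℓ−1))²` on diagonal bonds (`HubbardTTPrimeOpenBoxGrandCanonicalPressureCap`). Definitions with bodies: `placementCount`,
`uniformClusterWeight`; everything else PROVED; no named fact, no number.

## Mathlib / tree search

REUSED: `WeightedOpenClusterBounds` (`…le_mul_meanEnergy_of_posSemidef_reweight`, `varPressure_le_log_partitionFn_reweight`), `mem_shiftSet`,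
`card_shiftSet`, `KrausPattern.shiftSet_shiftSet_neg`, `HasFiniteRange.subset_thicken_singleton`, `mem_thicken_singleton_iff`, `mem_box`,
`mem_halfOpenBox`. `lean search 'placementCount|uniformClusterWeight|uniform.*admissible'` (2026-08-28): nothing.

## References

* R. Valentí, J. Stolze, P. J. Hirschfeld, Phys. Rev. B 43 (1991) 13743, §II (cluster weights = inverse covering multiplicities).
  [cite: ValentiStolzeHirschfeld1991, §II]
* P. W. Anderson, Phys. Rev. 83 (1951) 1260, eq. (2). [cite: Anderson1951, eq. (2)]
* R. B. Israel, *Convexity in the Theory of Lattice Gases* (1979), Lemma II.3.1. [cite: Israel1979, Lemma II.3.1]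
-/

noncomputable section

open scoped ComplexOrder BigOperators
open Finset Literature.InformationTheory.Entropy

namespace Literature.MathematicalPhysics.QuantumLattice

open Matrix HubbardWave0 Literature.Probability.LatticeModels ThermodynamicLimit
open scoped Matrix.Norms.L2Operator

variable {d : ℕ}

/-! ### §1 Placements of a shape inside a window -/

/-- **The placements of a shape `Y` inside the window `B`**: the translation vectors `v` with `Y + v ⊆ B`, listed choice-free among the
differences `b − y` (`b ∈ B`, `y ∈ Y`; for nonempty `Y` every placement is of this form). Empty for `Y = ∅`.
[cite: ValentiStolzeHirschfeld1991, §II] -/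
def placements (B Y : Finset (Site d)) : Finset (Site d) :=
  ((B ×ˢ Y).image fun p => p.1 - p.2).filter fun v => shiftSet v Y ⊆ B

/-- **The number of translates of `Y` inside `B`** (the covering multiplicity of the shape `Y` by the cluster `B`).
[cite: ValentiStolzeHirschfeld1991, §II] -/
def placementCount (B Y : Finset (Site d)) : ℕ := (placements B Y).card

/-- Membership: for nonempty `Y`, `v` is a placement iff `Y + v ⊆ B`. [cite: ValentiStolzeHirschfeld1991, §II] -/
theorem mem_placements_iff {B Y : Finset (Site d)} (hY : Y.Nonempty) {v : Site d} :
    v ∈ placements B Y ↔ shiftSet v Y ⊆ B := by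
  rw [placements, Finset.mem_filter, Finset.mem_image]
  constructor
  · exact fun h => h.2
  · intro h
    obtain ⟨y, hy⟩ := hY
    refine ⟨⟨(y + v, y), Finset.mem_product.2 ⟨h (by rw [mem_shiftSet, add_sub_cancel_right]; exact hy), hy⟩, ?_⟩, h⟩
    simp only [add_sub_cancel_left]

/-- No shape is placed from the empty set: `placements B ∅ = ∅`. [cite: ValentiStolzeHirschfeld1991, §II] -/
theorem placements_empty (B : Finset (Site d)) : placements B (∅ : Finset (Site d)) = ∅ := by
  rw [placements, Finset.product_empty, Finset.image_empty, Finset.filter_empty]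

/-- `placementCount B ∅ = 0`. [cite: ValentiStolzeHirschfeld1991, §II] -/
theorem placementCount_empty (B : Finset (Site d)) : placementCount B (∅ : Finset (Site d)) = 0 := by
  rw [placementCount, placements_empty, Finset.card_empty]

/-- Composition of translations: `(Y + u) + v = Y + (v + u)`. [folklore] -/
private theorem shiftSet_shiftSet_eq_shiftSet_add (v u : Site d) (Y : Finset (Site d)) :
    shiftSet v (shiftSet u Y) = shiftSet (v + u) Y := by
  ext x
  simp only [mem_shiftSet, sub_sub]

/-- **Translation invariance of the covering multiplicity**: `placementCount B (Y + u) = placementCount B Y`.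
[cite: ValentiStolzeHirschfeld1991, §II] -/
theorem placementCount_shiftSet (B Y : Finset (Site d)) (u : Site d) :
    placementCount B (shiftSet u Y) = placementCount B Y := by
  rcases Y.eq_empty_or_nonempty with rfl | hY
  · have h : shiftSet u (∅ : Finset (Site d)) = ∅ := by rw [shiftSet_eq_map, Finset.map_empty]
    rw [h]
  · have hY' : (shiftSet u Y).Nonempty := by
      obtain ⟨y, hy⟩ := hY
      exact ⟨y + u, by rw [mem_shiftSet, add_sub_cancel_right]; exact hy⟩
    rw [placementCount, placementCount]
    refine Finset.card_nbij' (fun v => v + u) (fun v => v - u) (fun v hv => ?_) (fun v hv => ?_) (fun v _ => add_sub_cancel_right v u)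
      (fun v _ => sub_add_cancel v u)
    · rw [Finset.mem_coe, mem_placements_iff hY'] at hv
      rw [Finset.mem_coe, mem_placements_iff hY, ← shiftSet_shiftSet_eq_shiftSet_add]
      exact hv
    · rw [Finset.mem_coe, mem_placements_iff hY] at hv
      rw [Finset.mem_coe, mem_placements_iff hY', shiftSet_shiftSet_eq_shiftSet_add, sub_add_cancel]
      exact hv

/-- **Rooted shapes**: for `X ∋ 0`, the placements of `X` inside `B` are exactly the `y ∈ B` with `X + y ⊆ B`, so
`placementCount B X = #{y ∈ B : X + y ⊆ B}`. [cite: ValentiStolzeHirschfeld1991, §II] -/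
theorem placementCount_eq_card_filter {B X : Finset (Site d)} (h0 : (0 : Site d) ∈ X) :
    placementCount B X = (B.filter fun y => shiftSet y X ⊆ B).card := by
  rw [placementCount]
  congr 1
  ext v
  rw [mem_placements_iff ⟨0, h0⟩, Finset.mem_filter]
  constructor
  · intro h
    exact ⟨h (by rw [mem_shiftSet, sub_self]; exact h0), h⟩
  · exact fun h => h.2

/-! ### §2 The uniform weight and its admissibility -/

/-- **The uniform cluster weight of mass `M`**: `w_B(Y) = M / #{translates of Y inside B}` (Valentí–Stolze–Hirschfeld's inverse covering
multiplicity; `0` on shapes with no placement, in particular on `∅`). [cite: ValentiStolzeHirschfeld1991, §II] -/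
def uniformClusterWeight (B : Finset (Site d)) (M : ℝ) (Y : Finset (Site d)) : ℝ := M / placementCount B Y

/-- No constant term: `w_B(∅) = 0`. [cite: ValentiStolzeHirschfeld1991, §II] -/
theorem uniformClusterWeight_empty (B : Finset (Site d)) (M : ℝ) : uniformClusterWeight B M (∅ : Finset (Site d)) = 0 := by
  rw [uniformClusterWeight, placementCount_empty, Nat.cast_zero, div_zero]

/-- **THE UNIFORM WEIGHT IS ADMISSIBLE** for every interaction `Ψ` all of whose interacting rooted shapes have a translate inside `B`:
for every `X ∋ 0` with `Ψ X ≠ 0`, `Σ_{y ∈ B : X + y ⊆ B} w_B(X + y) = M`. [cite: ValentiStolzeHirschfeld1991, §II] -/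
theorem uniformClusterWeight_admissible {Ψ : FermionInteraction d} (B : Finset (Site d)) (M : ℝ)
    (hfit : ∀ X : Finset (Site d), (0 : Site d) ∈ X → Ψ.Φ X ≠ 0 → ∃ v : Site d, shiftSet v X ⊆ B) :
    ∀ X : Finset (Site d), (0 : Site d) ∈ X → Ψ.Φ X ≠ 0 →
      ∑ y ∈ B with shiftSet y X ⊆ B, uniformClusterWeight B M (shiftSet y X) = M := by
  intro X h0 hΦ
  have hterm : ∀ y ∈ B.filter (fun y => shiftSet y X ⊆ B), uniformClusterWeight B M (shiftSet y X) = M / placementCount B X := by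
    intro y _
    rw [uniformClusterWeight, placementCount_shiftSet]
  rw [Finset.sum_congr rfl hterm, Finset.sum_const, nsmul_eq_mul, ← placementCount_eq_card_filter h0]
  have hpos : (0 : ℝ) < placementCount B X := by
    obtain ⟨v, hv⟩ := hfit X h0 hΦ
    have hvB : v ∈ B := hv (by rw [mem_shiftSet, sub_self]; exact h0)
    rw [placementCount_eq_card_filter h0]
    exact_mod_cast Finset.card_pos.2 ⟨v, Finset.mem_filter.2 ⟨hvB, hv⟩⟩
  field_simp

/-- **Range-`R` interactions fit in boxes of side `≥ 2⌊R⌋ + 1`**: an interacting rooted shape `X ∋ 0` of a range-`R` interaction lies in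
`[−⌊R⌋, ⌊R⌋]^d`, hence `X + (⌊R⌋,…,⌊R⌋) ⊆ [0,n)^d` for `2⌊R⌋ + 1 ≤ n`. [cite: BratteliRobinsonII1997, §6.2.1 (finite range)] -/
theorem exists_shiftSet_subset_halfOpenBox_of_apply_ne_zero {Ψ : FermionInteraction d} {R : ℝ} (hR : Ψ.HasFiniteRange R) {n : ℕ}
    (hn : 2 * ⌊R⌋₊ + 1 ≤ n) {X : Finset (Site d)} (h0 : (0 : Site d) ∈ X) (hΦ : Ψ.Φ X ≠ 0) :
    ∃ v : Site d, shiftSet v X ⊆ halfOpenBox d n := by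
  refine ⟨fun _ => (⌊R⌋₊ : ℤ), fun x hx => ?_⟩
  rw [mem_shiftSet] at hx
  have hx' := hR.subset_thicken_singleton hΦ h0 hx
  rw [mem_thicken_singleton_iff, sub_zero, mem_box] at hx'
  rw [mem_halfOpenBox]
  intro i
  have h := hx' i
  simp only [Pi.sub_apply] at h
  constructor <;> omega

/-! ### §3 Turnkey bounds with the uniform weight -/

namespace InfVolFermionState

variable {Ψ : FermionInteraction d} {R : ℝ} {ω : InfVolFermionState d}

/-- **T = 0, uniform weight**: if every interacting rooted shape fits in `B` and `H^{w_B}_B + G − q·1 ⪰ 0` (`w_B` the uniform weight of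
mass `M`, `G` killed by translation-invariant states), then `q ≤ M · e_Ψ(ω)` for every translation-invariant `ω`.
[cite: Anderson1951, eq. (2)] [cite: ValentiStolzeHirschfeld1991, §II] -/
theorem IsTranslationInvariant.le_mul_meanEnergy_of_posSemidef_uniformWeight (hω : ω.IsTranslationInvariant)
    (hT : Ψ.IsTranslationInvariant) (hR : Ψ.HasFiniteRange R) (B : Finset (Site d)) (M : ℝ)
    (hfit : ∀ X : Finset (Site d), (0 : Site d) ∈ X → Ψ.Φ X ≠ 0 → ∃ v : Site d, shiftSet v X ⊆ B)
    {G : FermionOp B} (hG0 : ∀ ω' : InfVolFermionState d, ω'.IsTranslationInvariant → (ω'.expect B G).re = 0) {q : ℝ}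
    (hq : ((⟨fun X => (uniformClusterWeight B M X : ℂ) • Ψ.Φ X⟩ : FermionInteraction d).localHamiltonian B + G -
      (q : ℂ) • (1 : FermionOp B)).PosSemidef) :
    q ≤ M * ω.meanEnergy Ψ R := by
  have h := hω.le_mul_meanEnergy_of_posSemidef_reweight hT hR B (uniformClusterWeight B M) M (uniformClusterWeight_admissible B M hfit)
    hG0 hq
  rwa [uniformClusterWeight_empty, zero_mul, sub_zero] at h

/-- **T > 0, uniform weight**: for `Ψ` Hermitian, translation covariant, of finite range `R` (`d ≥ 1`), a box `[0,n)^d` (`n ≥ 1`) containing a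
translate of every interacting rooted shape, every real `β` and every Hermitian multiplier `G` killed by translation-invariant states:
`n^d · P(β, Ψ) ≤ log Re Tr exp(−(β H^{w}_{[0,n)^d} − G))`, `w = uniformClusterWeight [0,n)^d n^d` (inverse covering multiplicities).
[cite: Israel1979, Lemma II.3.1] [cite: ValentiStolzeHirschfeld1991, §II] -/
theorem varPressure_le_log_partitionFn_uniformWeight (hd : 0 < d) (hH : Ψ.IsHermitian) (hT : Ψ.IsTranslationInvariant)
    (hR : Ψ.HasFiniteRange R) (β : ℝ) {n : ℕ} (hn : 1 ≤ n)
    (hfit : ∀ X : Finset (Site d), (0 : Site d) ∈ X → Ψ.Φ X ≠ 0 → ∃ v : Site d, shiftSet v X ⊆ halfOpenBox d n)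
    {G : FermionOp (halfOpenBox d n)} (hGh : G.IsHermitian)
    (hG0 : ∀ ω' : InfVolFermionState d, ω'.IsTranslationInvariant → (ω'.expect (halfOpenBox d n) G).re = 0) :
    (n : ℝ) ^ d * Ψ.varPressure β R ≤
      Real.log (partitionFn 1 ((β : ℂ) •
        (⟨fun X => (uniformClusterWeight (halfOpenBox d n) ((n : ℝ) ^ d) X : ℂ) • Ψ.Φ X⟩ : FermionInteraction d).localHamiltonian
          (halfOpenBox d n) - G)).re := by
  have h := varPressure_le_log_partitionFn_reweight hd hH hT hR β hn (uniformClusterWeight (halfOpenBox d n) ((n : ℝ) ^ d))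
    (uniformClusterWeight_admissible (halfOpenBox d n) ((n : ℝ) ^ d) hfit) hGh hG0
  rwa [uniformClusterWeight_empty, zero_mul, mul_zero, add_zero] at h

/-- **T > 0, uniform weight, no multiplier, box side from the range**: `2⌊R⌋ + 1 ≤ n` suffices for the fit, and
`n^d · P(β, Ψ) ≤ log Re Tr e^{−β H^{w}_{[0,n)^d}}`. [cite: Israel1979, Lemma II.3.1] [cite: ValentiStolzeHirschfeld1991, §II] -/
theorem varPressure_le_log_partitionFn_uniformWeight' (hd : 0 < d) (hH : Ψ.IsHermitian) (hT : Ψ.IsTranslationInvariant)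
    (hR : Ψ.HasFiniteRange R) (β : ℝ) {n : ℕ} (hn : 2 * ⌊R⌋₊ + 1 ≤ n) :
    (n : ℝ) ^ d * Ψ.varPressure β R ≤
      Real.log (partitionFn β
        ((⟨fun X => (uniformClusterWeight (halfOpenBox d n) ((n : ℝ) ^ d) X : ℂ) • Ψ.Φ X⟩ : FermionInteraction d).localHamiltonian
          (halfOpenBox d n))).re := by
  have h := varPressure_le_log_partitionFn_uniformWeight hd hH hT hR β (by omega : 1 ≤ n)
    (fun X h0 hΦ => exists_shiftSet_subset_halfOpenBox_of_apply_ne_zero hR hn h0 hΦ) (Matrix.isHermitian_zero)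
    (fun ω' _ => by rw [map_zero, Complex.zero_re])
  rwa [sub_zero, partitionFn_one_real_smul] at h

end InfVolFermionState

end Literature.MathematicalPhysics.QuantumLattice

end
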